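import Literature.AlgebraicGeometry.ModuliOfAbelianVarieties.SiegelCanonicalModel
import Literature.AlgebraicGeometry.ShimuraVarieties.UnitaryCurveAuxiliarySymplecticModuleV
import HarnessLib

/-!
# The CM structure of an `H^j`-orthogonal frame of the `W₀`-free symplectic module `(V_M, ψ_V)` — any rank `n`
# ([Deligne 1971] 4.18 / [Deligne 1979] Prop. 2.3.10; rank-`n`, `W₀`-free copy of `UnitaryAuxiliarySpecialPairCMStructure`)

Topic `AlgebraicGeometry/ShimuraVarieties`; namespace `Literature.AlgebraicGeometry.ShimuraVarieties.UnitaryCurve.AuxV`.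
THEOREMS ONLY (no definition, no named fact, no instance, no `sorry`; net Literature debt 0).  Cell `hodgecm-mathlib` (D-0151),
FLOOR 0, P6 «MOD programme», door (E) of `stub_RGD`, organ E3R (special-pair reciprocity `f_recip` of the chart `AuxChartGS`),
FILE A.  `--supports stmt-HodgeConjecture-24832`, count-neutral; HC_CM is proved only modulo the printed citations until rung 0 closes.

For the symplectic `ℚ`-space `(V_M, ψ_V)` of ★ `UnitaryCurveAuxiliarySymplecticModuleV` (`V_M = Mⁿ`, Gram matrix `ξ·H^j`, ★ `auxGramV`,
`auxFormV`) with a symplectic frame `β : Mⁿ ≃ ℚ^{2g}` (★ `SymplecticFrameV`), every `H^j`-ORTHOGONAL `M`-frame `B = (b₁ | … | b_n) ∈ GL_n(M)`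
(`ᵗc(B)·H^j·B` diagonal) makes `ℚ^{2g}` a free module of rank one over the CM algebra `F = M^{Fin n}` — `x = (x₁, …, x_n)` acts on the
line `M·b_k` by `x_k` — and this action is `ψ_δ`-self-adjoint for complex conjugation on every factor (orthogonality of the frame):
a CM structure ★ `CMStructure g δ (Fin n) (fun _ => M)` ([Deligne1971TravauxShimura] 4.18 «`L ⊂ End(V)` … produit de corps CM»).
For the unitary Shimura CURVE (`n = 2`, `M = F`, `j = id`, `H = J⋆`) and a special point `[ι₁ w]`, the frame is `B = (w′ | w)` with
`w′ ⊥ w`: the CM structure through which [Deligne1971TravauxShimura] 5.11 reads the reciprocity law at `[ι₁ w]`.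

* §1 (generic index type `ι`) `frameDiag_mulVecLin_{mul,one,add,zero,const,apply_frameVec}`, `frameVec_ne_zero`,
  `transpose_map_mul_gram_eq` — rank-free forms of the `Fin 1 ⊕ Fin 3` lemmas of ★ `UnitaryAuxiliarySpecialPairCMStructure`.
* §2 `auxFormV_mulVec_eq_of_transpose_map_mul`; **`exists_cmStructureV_of_orthogonal`** (HEAD).
* §3 `actMatrix_eq_frame_of_pinnedV` — a CM structure PINNED on the frame vectors (`act x (β(m·b_p)) = β((x_p·m)·b_p)`) has
  `actMatrix x = P_V · Res_{M/ℚ}(B·diag(x)·B⁻¹) · Q_V` (the `hact` input of FILE B `cmRepMatrix_eq_frameV`; rank-`n` copy of ★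
  `actMatrix_eq_frame_of_pinned`).

## References
* [Deligne1971TravauxShimura] P. Deligne, *Travaux de Shimura*, Sém. Bourbaki 389 (1971), 4.9 p. 147, 4.18 p. 150, 5.11 p. 158.
* [Deligne1979ShimuraVarieties] P. Deligne, *Variétés de Shimura* (1979), Prop. 2.3.10 (PDF p. 32 of Milne's translation).
* [Milne2005ShimuraVarieties] J. S. Milne, *Introduction to Shimura varieties* (2005), §6 p. 70, Ex. 12.4 (b) p. 112, Def. 12.5 p. 113.
-/

set_option autoImplicit false

noncomputable section

open Matrix NumberField

namespace Literature.AlgebraicGeometry.ShimuraVarieties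

namespace UnitaryCurve

namespace AuxV

open Literature.AlgebraicGeometry.ModuliOfAbelianVarieties
open Literature.AlgebraicGeometry.ShimuraVarieties.UnitaryCanonicalModel.Aux (ratBasis)

/-! ### §1. Frame-diagonal operators `P·diag(x)·P⁻¹` (any finite index type) -/

section FrameAlgebra

variable {M : Type} [Field M] {ι : Type} [Fintype ι] [DecidableEq ι]

/-- `x ↦ P·diag(x)·P⁻¹` («multiply the `p`-th frame vector by `x p`», as an `M`-linear map of `M^ι`) is multiplicative
(rank-free form of ★ `Aux.frameDiag_mulVecLin_mul`). [cite: Deligne1971TravauxShimura, 4.18 p. 150] -/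
theorem frameDiag_mulVecLin_mul (P : GL ι M) (x y : ι → M) :
    Matrix.mulVecLin (P.val * Matrix.diagonal (x * y) * (P⁻¹).val) =
      Matrix.mulVecLin (P.val * Matrix.diagonal x * (P⁻¹).val) ∘ₗ Matrix.mulVecLin (P.val * Matrix.diagonal y * (P⁻¹).val) := by
  refine LinearMap.ext fun v => ?_
  rw [LinearMap.comp_apply, Matrix.mulVecLin_apply, Matrix.mulVecLin_apply, Matrix.mulVecLin_apply, Matrix.mulVec_mulVec]
  congr 1
  rw [show Matrix.diagonal (x * y) = Matrix.diagonal x * Matrix.diagonal y from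
    (Matrix.diagonal_mul_diagonal x y).symm]
  simp only [Matrix.mul_assoc]
  rw [← Matrix.mul_assoc (P⁻¹).val P.val, Units.inv_mul, Matrix.one_mul]

/-- `P·diag(1)·P⁻¹ = id` (rank-free form of ★ `Aux.frameDiag_mulVecLin_one`). [cite: Deligne1971TravauxShimura, 4.18 p. 150] -/
theorem frameDiag_mulVecLin_one (P : GL ι M) : Matrix.mulVecLin (P.val * Matrix.diagonal 1 * (P⁻¹).val) = LinearMap.id := by
  refine LinearMap.ext fun v => ?_
  rw [Matrix.mulVecLin_apply, Matrix.diagonal_one', Matrix.mul_one, Units.mul_inv, Matrix.one_mulVec, LinearMap.id_apply]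

/-- `x ↦ P·diag(x)·P⁻¹` is additive (rank-free form of ★ `Aux.frameDiag_mulVecLin_add`). [cite: Deligne1971TravauxShimura, 4.18 p. 150] -/
theorem frameDiag_mulVecLin_add (P : GL ι M) (x y : ι → M) :
    Matrix.mulVecLin (P.val * Matrix.diagonal (x + y) * (P⁻¹).val) =
      Matrix.mulVecLin (P.val * Matrix.diagonal x * (P⁻¹).val) + Matrix.mulVecLin (P.val * Matrix.diagonal y * (P⁻¹).val) := by
  refine LinearMap.ext fun v => ?_
  rw [LinearMap.add_apply, Matrix.mulVecLin_apply, Matrix.mulVecLin_apply, Matrix.mulVecLin_apply, ← Matrix.add_mulVec,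
    ← Matrix.add_mul, ← Matrix.mul_add, Matrix.diagonal_add]
  rfl

/-- `P·diag(0)·P⁻¹ = 0` (rank-free form of ★ `Aux.frameDiag_mulVecLin_zero`). [cite: Deligne1971TravauxShimura, 4.18 p. 150] -/
theorem frameDiag_mulVecLin_zero (P : GL ι M) : Matrix.mulVecLin (P.val * Matrix.diagonal 0 * (P⁻¹).val) = 0 := by
  refine LinearMap.ext fun v => ?_
  rw [Matrix.mulVecLin_apply, Matrix.diagonal_zero', Matrix.mul_zero, Matrix.zero_mul, Matrix.zero_mulVec,
    LinearMap.zero_apply]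

/-- Scalars act by scalars: `P·diag(r,…,r)·P⁻¹ = r` (rank-free form of ★ `Aux.frameDiag_mulVecLin_const`).
[cite: Deligne1971TravauxShimura, 4.18 p. 150] -/
theorem frameDiag_mulVecLin_const (P : GL ι M) (r : M) (v : ι → M) :
    Matrix.mulVecLin (P.val * Matrix.diagonal (fun _ => r) * (P⁻¹).val) v = r • v := by
  have h : (Matrix.diagonal fun _ : ι => r) = r • (1 : Matrix ι ι M) := by
    ext i k
    simp [Matrix.diagonal_apply, Matrix.one_apply, Matrix.smul_apply]
  rw [Matrix.mulVecLin_apply, h, Matrix.mul_smul, Matrix.mul_one, Matrix.smul_mul, Units.mul_inv, Matrix.smul_mulVec,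
    Matrix.one_mulVec]

/-- The frame vectors are eigenvectors: `(P·diag(x)·P⁻¹)(m·P e_p) = (x_p m)·P e_p` (rank-free form of ★
`Aux.frameDiag_mulVecLin_apply_frameVec`). [cite: Deligne1971TravauxShimura, 4.18 p. 150] -/
theorem frameDiag_mulVecLin_apply_frameVec (P : GL ι M) (x : ι → M) (p : ι) (m : M) :
    Matrix.mulVecLin (P.val * Matrix.diagonal x * (P⁻¹).val) (m • P.val *ᵥ Pi.single p 1) = (x p * m) • P.val *ᵥ Pi.single p 1 := by
  have hs : x p • (Pi.single p (1 : M) : ι → M) = Pi.single p (x p) := by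
    rw [← Pi.single_smul', smul_eq_mul, mul_one]
  rw [Matrix.mulVecLin_apply, Matrix.mulVec_smul, Matrix.mulVec_mulVec, Matrix.mul_assoc, Matrix.mul_assoc,
    Units.inv_mul, Matrix.mul_one, ← Matrix.mulVec_mulVec, Matrix.diagonal_mulVec_single, mul_one, ← hs,
    Matrix.mulVec_smul, smul_smul, mul_comm m]

/-- A frame vector `P e_p` of an invertible `P` is nonzero (rank-free form of ★ `Aux.frameVec_ne_zero`).
[cite: Deligne1971TravauxShimura, 4.18 p. 150] -/
theorem frameVec_ne_zero (P : GL ι M) (p : ι) : P.val *ᵥ Pi.single p (1 : M) ≠ 0 := by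
  intro h
  have h1 : (P⁻¹).val *ᵥ (P.val *ᵥ Pi.single p (1 : M)) = Pi.single p 1 := by
    rw [Matrix.mulVec_mulVec, ← Units.val_mul, inv_mul_cancel, Units.val_one, Matrix.one_mulVec]
  rw [h, Matrix.mulVec_zero] at h1
  have h2 := congrFun h1 p
  simp at h2

/-- A diagonal matrix commutes with a matrix whose off-diagonal entries vanish. [cite: Deligne1971TravauxShimura, 4.18 p. 150] -/
private theorem diagonal_mul_comm_of_offDiag (d : ι → M) (Δ : Matrix ι ι M)
    (hΔ : ∀ i k, i ≠ k → Δ i k = 0) : Matrix.diagonal d * Δ = Δ * Matrix.diagonal d := by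
  ext i k
  rw [Matrix.diagonal_mul, Matrix.mul_diagonal]
  by_cases hik : i = k
  · subst hik; exact mul_comm _ _
  · rw [hΔ i k hik, mul_zero, zero_mul]

/-- **Key matrix identity** (any index type): for a frame `P` whose Gram matrix `Δ = ᵗc(P)·G·P` in a sesquilinear form with matrix `G`
(`c` a ring endomorphism applied entrywise) has no off-diagonal entries, `ᵗc(P·diag(x)·P⁻¹)·G = G·(P·diag(c∘x)·P⁻¹)` — the adjoint of
«multiply the `p`-th frame vector by `x_p`» is «multiply it by `c(x_p)`» (rank-free form of ★ `Aux.transpose_map_mul_gram_eq`).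
[cite: Deligne1971TravauxShimura, 4.18 p. 150] -/
theorem transpose_map_mul_gram_eq {F : Type} [FunLike F M M] [RingHomClass F M M] (c : F)
    (G : Matrix ι ι M) (P : GL ι M) (hΔ : ∀ i k, i ≠ k → ((P.val.map c)ᵀ * G * P.val) i k = 0) (x : ι → M) :
    ((P.val * Matrix.diagonal x * (P⁻¹).val).map c)ᵀ * G = G * (P.val * Matrix.diagonal (fun i => c (x i)) * (P⁻¹).val) := by
  have hPinvP : ((P⁻¹).val.map c) * (P.val.map c) = 1 := by
    rw [← Matrix.map_mul, Units.inv_mul, Matrix.map_one c (map_zero c) (map_one c)]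
  have hPPinv : (P.val.map c) * ((P⁻¹).val.map c) = 1 := by
    rw [← Matrix.map_mul, Units.mul_inv, Matrix.map_one c (map_zero c) (map_one c)]
  have hU : IsUnit (P.val.map c)ᵀ := by
    rw [Matrix.isUnit_transpose]
    exact ⟨⟨P.val.map c, (P⁻¹).val.map c, hPPinv, hPinvP⟩, rfl⟩
  have hV : IsUnit P.val := Units.isUnit P
  have hD : (Matrix.diagonal x).map c = Matrix.diagonal (fun i => c (x i)) := Matrix.diagonal_map (map_zero c)
  refine hU.mul_left_cancel (hV.mul_right_cancel ?_)
  have hcomm := diagonal_mul_comm_of_offDiag (fun i => c (x i)) _ hΔ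
  calc (P.val.map c)ᵀ * (((P.val * Matrix.diagonal x * (P⁻¹).val).map c)ᵀ * G) * P.val
      = (((P.val * Matrix.diagonal x * (P⁻¹).val).map c) * P.val.map c)ᵀ * G * P.val := by
        rw [Matrix.transpose_mul _ (P.val.map c)]
        simp only [Matrix.mul_assoc]
    _ = (P.val.map c * Matrix.diagonal (fun i => c (x i)))ᵀ * G * P.val := by
        rw [Matrix.map_mul, Matrix.map_mul, hD, Matrix.mul_assoc (P.val.map c * _), hPinvP, Matrix.mul_one]
    _ = Matrix.diagonal (fun i => c (x i)) * ((P.val.map c)ᵀ * G * P.val) := by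
        rw [Matrix.transpose_mul, Matrix.diagonal_transpose]
        simp only [Matrix.mul_assoc]
    _ = ((P.val.map c)ᵀ * G * P.val) * Matrix.diagonal (fun i => c (x i)) := hcomm
    _ = (P.val.map c)ᵀ * (G * (P.val * Matrix.diagonal (fun i => c (x i)) * (P⁻¹).val)) * P.val := by
        simp only [Matrix.mul_assoc]
        rw [Units.inv_mul, Matrix.mul_one]

omit [DecidableEq ι] in
/-- `ᵗ(A u)·y = ᵗu·(ᵗA y)`. [cite: Deligne1971TravauxShimura, 4.18 p. 150] -/
private theorem mulVec_dotProduct_eq_dotProduct_transpose_mulVec (A : Matrix ι ι M) (u y : ι → M) :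
    (A *ᵥ u) ⬝ᵥ y = u ⬝ᵥ (Aᵀ *ᵥ y) := by
  rw [Matrix.dotProduct_mulVec, Matrix.vecMul_transpose]

end FrameAlgebra

/-! ### §2. The CM structure of an orthogonal frame of `(V_M, ψ_V)` -/

section OrthogonalFrame

variable {L : Type} [Field L] {M : Type} [Field M] [NumberField M] [IsCMField M] {j : L →+* M}
  {n : ℕ} {H : Matrix (Fin n) (Fin n) L} {ξ : M} {g : ℕ} {δ : Fin g → ℕ}

/-- `ψ_V(A v, w) = ψ_V(v, A' w)` from the matrix identity `ᵗc(A)·G = G·A'`, for the trace form `ψ_V = Tr_{M/ℚ}(ᵗc(·)·G·(·))`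
(★ `auxFormV`, `G =` ★ `auxGramV = ξ·H^j`). [cite: Deligne1979ShimuraVarieties, Prop. 2.3.10 (PDF p. 32)] -/
theorem auxFormV_mulVec_eq_of_transpose_map_mul (A A' : Matrix (Fin n) (Fin n) M)
    (h : (A.map (IsCMField.complexConj M))ᵀ * auxGramV M j H ξ = auxGramV M j H ξ * A') (v w : Fin n → M) :
    auxFormV M j H ξ (A *ᵥ v) w = auxFormV M j H ξ v (A' *ᵥ w) := by
  rw [auxFormV_apply, auxFormV_apply]
  congr 1
  have hc : (fun i => IsCMField.complexConj M ((A *ᵥ v) i)) =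
      A.map (IsCMField.complexConj M) *ᵥ fun i => IsCMField.complexConj M (v i) := by
    funext i
    simp [Matrix.mulVec, dotProduct, map_sum, map_mul]
  rw [hc, mulVec_dotProduct_eq_dotProduct_transpose_mulVec, Matrix.mulVec_mulVec, h, ← Matrix.mulVec_mulVec]

/-- **The CM structure of an `H^j`-orthogonal frame of `(V_M, ψ_V)`** ([Deligne1971TravauxShimura] 4.18, [Deligne1979ShimuraVarieties]
Prop. 2.3.10; `W₀`-free, rank-`n` copy of ★ `Aux.exists_cmStructure_of_orthogonal`): for a symplectic frame `β : (V_M, ψ_V) ≃ (ℚ^{2g}, ψ_δ)`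
(★ `SymplecticFrameV`) and an `M`-frame `B ∈ GL_n(M)` of `V_M` with `ᵗc(B)·H^j·B` DIAGONAL, there is a CM structure (★ `CMStructure`) of
the CM algebra `F = M^{Fin n}` on `(ℚ^{2g}, ψ_δ)` in which `x = (x₁, …, x_n) ∈ F` acts — transported through `β` — on the line `M·b_p ⊂ V_M`
by `x_p` (`B·e_p = b_p` the `p`-th frame vector): `ψ_δ`-self-adjointness for complex conjugation on every factor is the orthogonality of
the frame, `Σ_p [M:ℚ] = n·[M:ℚ] = 2g` is read off `β`.  For the curve (`n = 2`, `B = (w′ | w)`, `w′ ⊥ w`) this is the CM structure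
`U(M·w′) × U(M·w)`-torus of the special point `[ι₁ w]`. [cite: Deligne1971TravauxShimura, 4.18 p. 150]
[cite: Deligne1979ShimuraVarieties, Prop. 2.3.10 (PDF p. 32)] [cite: Milne2005ShimuraVarieties, Def. 12.5 p. 113] -/
theorem exists_cmStructureV_of_orthogonal (Fr : SymplecticFrameV M j H ξ g δ) (B : GL (Fin n) M)
    (hB : ∀ i k : Fin n, i ≠ k →
      (((B : Matrix (Fin n) (Fin n) M).map (IsCMField.complexConj M))ᵀ * H.map j * (B : Matrix (Fin n) (Fin n) M)) i k = 0) :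
    ∃ c : CMStructure g δ (Fin n) (fun _ => M),
      ∀ (x : Fin n → M) (p : Fin n) (m : M),
        c.act x (Fr.β (m • (B : Matrix (Fin n) (Fin n) M) *ᵥ Pi.single p 1)) =
          Fr.β ((x p * m) • (B : Matrix (Fin n) (Fin n) M) *ᵥ Pi.single p 1) := by
  classical
  -- (1) the frame `B` has an off-diagonal-free Gram matrix `ᵗc(B)·G·B` for `G = ξ·H^j`
  have hG : auxGramV M j H ξ = ξ • H.map j := rfl
  have hΔ : ∀ i k, i ≠ k → ((B.val.map (IsCMField.complexConj M))ᵀ * auxGramV M j H ξ * B.val) i k = 0 := by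
    intro i k hik
    rw [hG, Matrix.mul_smul, Matrix.smul_mul, Matrix.smul_apply, hB i k hik, smul_zero]
  -- (2) the action `x ↦ β ∘ (B·diag(x)·B⁻¹) ∘ β⁻¹`
  let actF : (Fin n → M) → Module.End ℚ (Fin g ⊕ Fin g → ℚ) := fun x =>
    Fr.β.toLinearMap ∘ₗ (Matrix.mulVecLin (B.val * Matrix.diagonal x * (B⁻¹).val)).restrictScalars ℚ ∘ₗ Fr.β.symm.toLinearMap
  have actF_apply : ∀ x v, actF x v = Fr.β (Matrix.mulVecLin (B.val * Matrix.diagonal x * (B⁻¹).val) (Fr.β.symm v)) :=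
    fun _ _ => rfl
  let act : (Fin n → M) →ₐ[ℚ] Module.End ℚ (Fin g ⊕ Fin g → ℚ) :=
    { toFun := actF
      map_one' := by
        refine LinearMap.ext fun v => ?_
        rw [actF_apply, frameDiag_mulVecLin_one, LinearMap.id_apply, LinearEquiv.apply_symm_apply, Module.End.one_apply]
      map_mul' := fun x y => by
        refine LinearMap.ext fun v => ?_
        rw [Module.End.mul_apply, actF_apply, actF_apply, actF_apply, frameDiag_mulVecLin_mul, LinearMap.comp_apply,
          LinearEquiv.symm_apply_apply]
      map_zero' := by
        refine LinearMap.ext fun v => ?_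
        rw [actF_apply, frameDiag_mulVecLin_zero, LinearMap.zero_apply, map_zero, LinearMap.zero_apply]
      map_add' := fun x y => by
        refine LinearMap.ext fun v => ?_
        rw [LinearMap.add_apply, actF_apply, actF_apply, actF_apply, frameDiag_mulVecLin_add, LinearMap.add_apply, map_add]
      commutes' := fun r => by
        refine LinearMap.ext fun v => ?_
        have hr : (algebraMap ℚ (Fin n → M) r) = fun _ => algebraMap ℚ M r := funext fun _ => rfl
        rw [Module.algebraMap_end_apply, actF_apply, hr, frameDiag_mulVecLin_const, algebraMap_smul, map_smul,
          LinearEquiv.apply_symm_apply] }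
  have act_apply : ∀ x v, act x v = Fr.β (Matrix.mulVecLin (B.val * Matrix.diagonal x * (B⁻¹).val) (Fr.β.symm v)) :=
    fun _ _ => rfl
  refine ⟨{ act := act, act_injective := ?_, sum_finrank_eq := ?_, adjoint := ?_ }, ?_⟩
  · -- `act` is injective: read it on the frame vectors
    intro x y hxy
    funext p
    have h := LinearMap.congr_fun hxy (Fr.β (B.val *ᵥ Pi.single p 1))
    rw [act_apply, act_apply, LinearEquiv.symm_apply_apply] at h
    have hx := frameDiag_mulVecLin_apply_frameVec B x p 1
    have hy := frameDiag_mulVecLin_apply_frameVec B y p 1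
    rw [one_smul, mul_one] at hx hy
    rw [hx, hy] at h
    have h' := sub_eq_zero.mpr (Fr.β.injective h)
    rw [← sub_smul, smul_eq_zero] at h'
    rcases h' with h0 | h0
    · exact sub_eq_zero.mp h0
    · exact absurd h0 (frameVec_ne_zero B p)
  · -- `Σ_p [M:ℚ] = 2g`
    show ∑ _p : Fin n, Module.finrank ℚ M = 2 * g
    have hfr : Module.finrank ℚ (Fin n → M) = ∑ _p : Fin n, Module.finrank ℚ M := Module.finrank_pi_fintype ℚ
    rw [← hfr, Fr.β.finrank_eq, Module.finrank_pi, Fintype.card_sum, Fintype.card_fin, two_mul]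
  · -- `ψ_δ`-self-adjointness
    intro x v w
    have key := auxFormV_mulVec_eq_of_transpose_map_mul (j := j) (H := H) (ξ := ξ) _ _
      (transpose_map_mul_gram_eq (IsCMField.complexConj M) (auxGramV M j H ξ) B hΔ x) (Fr.β.symm v) (Fr.β.symm w)
    rw [Fr.gram, Fr.gram, LinearEquiv.apply_symm_apply, LinearEquiv.apply_symm_apply] at key
    rw [act_apply, act_apply, Matrix.mulVecLin_apply, Matrix.mulVecLin_apply]
    exact key
  · -- the action on the frame vectors
    intro x p m
    rw [act_apply, LinearEquiv.symm_apply_apply, frameDiag_mulVecLin_apply_frameVec]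

end OrthogonalFrame

/-! ### §3. A CM structure pinned on the frame vectors is frame-diagonal in the symplectic coordinates -/

section Pinned

variable {L : Type} [Field L] {M : Type} [Field M] [NumberField M] [IsCMField M] {j : L →+* M}
  {n : ℕ} {H : Matrix (Fin n) (Fin n) L} {ξ : M} {g : ℕ} {δ : Fin g → ℕ}

/-- **Bridge to `hact`** (rank-`n`, `W₀`-free copy of ★ `Aux.actMatrix_eq_frame_of_pinned`).  If a CM structure `c` indexed by `Fin n` with
all fields `M` acts — transported through the symplectic frame `β` — on the `p`-th FRAME VECTOR `B·e_p` of `V_M` by the scalar `x p` (the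
pinned specification of `exists_cmStructureV_of_orthogonal`: `act x (β(m·b_p)) = β((x_p·m)·b_p)`), then its action read in the standard
basis is `β`-conjugate to the frame-diagonal matrix: `actMatrix x = P_V · Res_{M/ℚ}(B·diag(x)·B⁻¹) · Q_V` (★ `framePV`, `frameQV`,
★ `resMatrix` along ★ `ratBasis M`) — the hypothesis `hact` of FILE B's `cmRepMatrix_eq_frameV`.  (The frame vectors `m·b_p` span `Mⁿ`
over `ℚ`, both sides are `ℚ`-linear.) [cite: Deligne1971TravauxShimura, 4.9 p. 147 and 4.18 p. 150] [cite: Deligne1979ShimuraVarieties, Prop. 2.3.10] -/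
theorem actMatrix_eq_frame_of_pinnedV (Fr : SymplecticFrameV M j H ξ g δ) (B : GL (Fin n) M)
    (c : CMStructure g δ (Fin n) (fun _ => M))
    (hpin : ∀ (x : Fin n → M) (p : Fin n) (m : M),
      c.act x (Fr.β (m • (B : Matrix (Fin n) (Fin n) M) *ᵥ Pi.single p 1)) =
        Fr.β ((x p * m) • (B : Matrix (Fin n) (Fin n) M) *ᵥ Pi.single p 1))
    (x : Fin n → M) :
    c.actMatrix x =
      framePV Fr * resMatrix (ratBasis M)
        ((B : Matrix (Fin n) (Fin n) M) * Matrix.diagonal x * ((B⁻¹ : GL (Fin n) M) : Matrix (Fin n) (Fin n) M)) * frameQV Fr := by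
  classical
  set D : Matrix (Fin n) (Fin n) M :=
    (B : Matrix (Fin n) (Fin n) M) * Matrix.diagonal x * ((B⁻¹ : GL (Fin n) M) : Matrix (Fin n) (Fin n) M) with hD
  -- (1) `D` multiplies the `p`-th frame vector by `x p`
  have hDvec : ∀ p : Fin n, D *ᵥ (B.val *ᵥ Pi.single p 1) = x p • (B.val *ᵥ Pi.single p 1) := by
    intro p
    have h := frameDiag_mulVecLin_apply_frameVec B x p 1
    rw [one_smul, mul_one, Matrix.mulVecLin_apply] at h
    exact h
  -- (2) the two `ℚ`-linear actions agree on `Mⁿ` (the frame vectors `m·b_p` span it)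
  have hsumD : ∀ f : Fin n → (Fin n → M), D *ᵥ (∑ p, f p) = ∑ p, D *ᵥ f p := fun f => by
    simpa only [Matrix.mulVecLin_apply] using map_sum (Matrix.mulVecLin D) f Finset.univ
  have hsumP : ∀ f : Fin n → (Fin n → M), B.val *ᵥ (∑ p, f p) = ∑ p, B.val *ᵥ f p := fun f => by
    simpa only [Matrix.mulVecLin_apply] using map_sum (Matrix.mulVecLin B.val) f Finset.univ
  have hagree : ∀ w : Fin n → M, c.act x (Fr.β w) = Fr.β (D *ᵥ w) := by
    intro w
    have hw : w = ∑ p, ((B⁻¹).val *ᵥ w) p • (B.val *ᵥ Pi.single p (1 : M)) := by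
      calc w = B.val *ᵥ ((B⁻¹).val *ᵥ w) := by
            rw [Matrix.mulVec_mulVec, ← Units.val_mul, mul_inv_cancel, Units.val_one, Matrix.one_mulVec]
        _ = B.val *ᵥ (∑ p, ((B⁻¹).val *ᵥ w) p • Pi.single p (1 : M)) := by
            congr 1
            conv_lhs => rw [← Finset.univ_sum_single ((B⁻¹).val *ᵥ w)]
            refine Finset.sum_congr rfl fun p _ => ?_
            rw [← Pi.single_smul, smul_eq_mul, mul_one]
        _ = ∑ p, ((B⁻¹).val *ᵥ w) p • (B.val *ᵥ Pi.single p 1) := by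
            rw [hsumP]
            refine Finset.sum_congr rfl fun p _ => ?_
            rw [Matrix.mulVec_smul]
    rw [hw, map_sum, map_sum, hsumD, map_sum]
    refine Finset.sum_congr rfl fun p _ => ?_
    rw [hpin x p, Matrix.mulVec_smul, hDvec p, smul_smul, mul_comm]
  -- (3) hence the linear maps, hence the matrices, agree
  have hlin : c.act x =
      Fr.β.toLinearMap ∘ₗ ((Matrix.mulVecLin D).restrictScalars ℚ) ∘ₗ Fr.β.symm.toLinearMap := by
    refine LinearMap.ext fun v => ?_
    rw [LinearMap.comp_apply, LinearMap.comp_apply, LinearEquiv.coe_toLinearMap, LinearEquiv.coe_toLinearMap,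
      LinearMap.coe_restrictScalars, Matrix.mulVecLin_apply, ← hagree, LinearEquiv.apply_symm_apply]
  rw [CMStructure.actMatrix_def, hlin, ← LinearMap.toMatrix_eq_toMatrix',
    LinearMap.toMatrix_comp (Pi.basisFun ℚ (Fin g ⊕ Fin g)) (resBasis (m := Fin n) (ratBasis M))
      (Pi.basisFun ℚ (Fin g ⊕ Fin g)),
    LinearMap.toMatrix_comp (Pi.basisFun ℚ (Fin g ⊕ Fin g)) (resBasis (m := Fin n) (ratBasis M))
      (resBasis (m := Fin n) (ratBasis M)),
    toMatrix_resBasis_mulVecLin, Matrix.mul_assoc]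
  rfl

end Pinned

end AuxV

end UnitaryCurve

end Literature.AlgebraicGeometry.ShimuraVarieties

end
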